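import Mathlib
import Literature.Computability.AlgebraicComplexity.SymmetricArithCircuit
import Literature.Computability.AlgebraicComplexity.DawarWilsenach2025
import Literature.Computability.AlgebraicComplexity.DawarWilsenach2025Proofs
import HarnessLib

/-!
# Reduced symmetric arithmetic circuits are rigid; orbits of rigid circuits; the support bound on orbits

Topic `Computability/AlgebraicComplexity`, namespace `Literature.Computability.AlgebraicComplexity`.
Companion of `SymmetricArithCircuit.lean` (Dawar–Wilsenach labelled circuits, Def. 2.2; automorphisms
Def. 3.6; `IsSymmetric` Def. 3.7; `IsRigid`) and `DawarWilsenach2025.lean` (`autOrbit`, `orbitSize` =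
`ORB`, §3.3).  Everything here is PROVED; no named facts.

The orbit size `ORB(C)` of Dawar–Wilsenach counts orbits under ALL automorphisms extending SOME group
element (§3.3).  For a circuit that comes with a DESIGNED family of automorphisms `perm γ` (one per
`γ ∈ Γ`, as every explicit construction in the tree does) the designed orbit `{perm γ g : γ ∈ Γ}` is only
a LOWER bound for the automorphism orbit of `g`: further ("pure") automorphisms may permute structurally
identical gates.  The standard remedy (Anderson–Dawar 2017, Lemma 7 / Prop. 9; Dawar–Wilsenach 2021,
Def. 3.13 "reduced" and "reduced circuits have unique extensions"; Dawar–Wilsenach 2025, remark before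
Cor. 6.5) is to work with REDUCED circuits — no two gates with the same label and the same children — which
are RIGID, so that their orbits ARE the designed orbits.  This file records that remedy for the tree's
arithmetic circuits, together with the counting half of the support calculus (Dawar–Wilsenach 2025
Def. 6.1): a gate moved only according to the values of `γ` on a set `S` of `k` indices has at most
`n (n-1) ⋯ (n-k+1) ≤ n^k` images.

* `LabelledArithCircuit.IsReduced` — no two gates share label and children (input gates are already
  separated by their labels, Def. 2.2);
* `IsReduced.perm_unique` / `IsReduced.isRigid` — a reduced circuit has at most one automorphism over
  each `γ` (induction along the wires: an automorphism is determined on a gate by its values on the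
  children);
* `IsReduced.autOrbit_subset_range`, `IsReduced.ncard_autOrbit_le`, `IsReduced.orbitSize_le` — for a
  reduced circuit with designed automorphisms `perm γ`, `Orb(g) ⊆ {perm γ g}` and hence
  `ORB(C) ≤ max_g |{perm γ g : γ}|`;
* `ncard_range_le_descFactorial_of_agree` — if `f : Sym(U) → α` depends only on the restriction of the
  permutation to a finite set `S`, then `|range f| ≤ |U|·(|U|-1)⋯(|U|-|S|+1) ≤ |U|^|S|`;
  `ncard_orbit_le_descFactorial_of_supports` — the same for the orbit of a point supported by `S` in any
  `Sym(U)`-set (Mathlib `MulAction.Supports`);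
* `IsReduced.orbitSize_le_pow_of_supports` — **orbit bound through rigid supports**: a reduced circuit
  whose designed automorphisms move every gate only according to `γ` restricted to a support of size
  `≤ k` has `ORB ≤ |U|^k`.

## References
* A. Dawar, G. Wilsenach, *Symmetric arithmetic circuits*, ToC 21 (2025), Defs. 2.2, 3.6, 3.7, §3.3
  (`Orb`, `ORB`, rigid), Def. 6.1 (supports), remark before Cor. 6.5. [DawarWilsenach2025]
* A. Dawar, G. Wilsenach, *Symmetric circuits for rank logic*, ACM ToCL 23 (2021/22), §3 (Def. 3.13,
  reduced circuits; unique extensions). [DawarWilsenach2021]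
* M. Anderson, A. Dawar, *On symmetric circuits and fixed-point logics*, Theory Comput. Syst. 60 (2017),
  §3–4 (rigid circuits, Lemma 7; supports). [AndersonDawar2016]
-/

noncomputable section

namespace Literature.Computability.AlgebraicComplexity

namespace LabelledArithCircuit

universe u v w z

variable {K : Type u} {X : Type v} {Y : Type z} {G : Type w}

/-! ### Reduced circuits -/

/-- A labelled circuit is **reduced** if no two distinct gates have the same label and the same children
("no two gates compute the same basis function on the same arguments"; input gates are already pairwise
distinct by their labels, Def. 2.2). [cite: DawarWilsenach2021, §3 (Def. 3.13, reduced circuit)] -/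
def IsReduced (C : LabelledArithCircuit K X Y G) : Prop :=
  ∀ g g' : G, C.label g = C.label g' → C.children g = C.children g' → g = g'

variable {Γ : Type*} [Group Γ] [MulAction Γ X] [MulAction Γ Y]

/-- **In a reduced circuit an automorphism is determined by the group element it extends**: two
automorphisms extending the same `γ` agree on every gate (induction along the wires: they agree on the
children, hence the images have the same children and the same label `γ • label g`).
[cite: DawarWilsenach2021, §3 (reduced circuits have unique extensions)] -/
theorem IsReduced.perm_apply_eq {C : LabelledArithCircuit K X Y G} (hR : C.IsReduced) {γ : Γ}
    {π π' : Equiv.Perm G} (h : C.IsAutomorphismExtending γ π) (h' : C.IsAutomorphismExtending γ π')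
    (g : G) : π g = π' g := by
  induction g using C.wf.induction with
  | h g ih =>
    apply hR
    · rw [h.label_apply, h'.label_apply]
    · rw [h.children_apply, h'.children_apply]
      ext k
      simp only [Finset.mem_map, Equiv.coe_toEmbedding]
      constructor
      · rintro ⟨j, hj, rfl⟩
        exact ⟨j, hj, (ih j hj).symm⟩
      · rintro ⟨j, hj, rfl⟩
        exact ⟨j, hj, ih j hj⟩

/-- **Reduced circuits are rigid** (Dawar–Wilsenach Def. 3.6: every `γ` has at most one extension).
[cite: DawarWilsenach2021, §3 (reduced circuits have unique extensions)] -/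
theorem IsReduced.isRigid {C : LabelledArithCircuit K X Y G} (hR : C.IsReduced) : C.IsRigid Γ :=
  fun _ _ _ h h' => Equiv.ext (hR.perm_apply_eq h h')

/-- For a reduced circuit with a designed automorphism `perm γ` over every `γ`, the orbit of a gate under
ALL automorphisms (Dawar–Wilsenach's `Orb(g)`) is contained in its designed orbit `{perm γ g : γ ∈ Γ}`.
[cite: DawarWilsenach2025, §3.3 (Orb)] -/
theorem IsReduced.autOrbit_subset_range {C : LabelledArithCircuit K X Y G} (hR : C.IsReduced)
    (perm : Γ → Equiv.Perm G) (hperm : ∀ γ, C.IsAutomorphismExtending γ (perm γ)) (g : G) :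
    C.autOrbit Γ g ⊆ Set.range fun γ => perm γ g := by
  rintro _ ⟨γ, π, hπ, rfl⟩
  exact ⟨γ, (hR.perm_apply_eq hπ (hperm γ) g).symm⟩

/-- Hence every orbit of a reduced circuit with designed automorphisms is at most as large as the
designed orbit. [cite: DawarWilsenach2025, §3.3 (Orb)] -/
theorem IsReduced.ncard_autOrbit_le [Fintype G] {C : LabelledArithCircuit K X Y G} (hR : C.IsReduced)
    (perm : Γ → Equiv.Perm G) (hperm : ∀ γ, C.IsAutomorphismExtending γ (perm γ)) (g : G) :
    (C.autOrbit Γ g).ncard ≤ (Set.range fun γ => perm γ g).ncard :=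
  Set.ncard_le_ncard (hR.autOrbit_subset_range perm hperm g) (Set.toFinite _)

/-- **`ORB` of a reduced circuit is bounded by its designed orbits.**
[cite: DawarWilsenach2025, §3.3 (ORB)] -/
theorem IsReduced.orbitSize_le [Fintype G] {C : LabelledArithCircuit K X Y G} (hR : C.IsReduced)
    (perm : Γ → Equiv.Perm G) (hperm : ∀ γ, C.IsAutomorphismExtending γ (perm γ)) {B : ℕ}
    (hB : ∀ g, (Set.range fun γ => perm γ g).ncard ≤ B) : C.orbitSize Γ ≤ B :=
  Finset.sup_le fun g _ => (hR.ncard_autOrbit_le perm hperm g).trans (hB g)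

/-- A reduced circuit with designed automorphisms is `Γ`-symmetric (Def. 3.7) — recorded for
convenience. [cite: DawarWilsenach2025, Def. 3.7] -/
theorem isSymmetric_of_perm {C : LabelledArithCircuit K X Y G} (perm : Γ → Equiv.Perm G)
    (hperm : ∀ γ, C.IsAutomorphismExtending γ (perm γ)) : C.IsSymmetric Γ :=
  fun γ => ⟨perm γ, hperm γ⟩

end LabelledArithCircuit

/-! ### Counting: a gate moved only through `k` indices has at most `n^{(k)}` images -/

section Counting

variable {U : Type*} [Fintype U] [DecidableEq U] {α : Type*}

/-- If `f : Sym(U) → α` depends only on the values of the permutation on a finite set `S`, then `f`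
takes at most `|U| (|U|-1) ⋯ (|U|-|S|+1)` values (the number of injections `S ↪ U`).
[cite: DawarPagoSeppelt2025, §5 (one gate per tuple of support values)] -/
theorem ncard_range_le_descFactorial_of_agree (S : Finset U) (f : Equiv.Perm U → α)
    (hf : ∀ σ τ : Equiv.Perm U, (∀ u ∈ S, σ u = τ u) → f σ = f τ) :
    (Set.range f).ncard ≤ (Fintype.card U).descFactorial S.card := by
  classical
  -- restriction of a permutation to `S`, an injection `S ↪ U`
  let r : Equiv.Perm U → (↥S ↪ U) := fun σ =>
    ⟨fun s => σ s.1, fun a b h => Subtype.ext (σ.injective h)⟩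
  -- `f` factors through `r`
  let F : (↥S ↪ U) → α := fun e =>
    if h : ∃ σ, r σ = e then f (Classical.choose h) else f 1
  have hF : ∀ σ, F (r σ) = f σ := by
    intro σ
    have hex : ∃ τ, r τ = r σ := ⟨σ, rfl⟩
    simp only [F, dif_pos hex]
    refine hf _ _ fun u hu => ?_
    have := congrArg (fun e : ↥S ↪ U => e ⟨u, hu⟩) (Classical.choose_spec hex)
    exact this
  have hsub : Set.range f ⊆ Set.range F := by
    rintro _ ⟨σ, rfl⟩
    exact ⟨r σ, hF σ⟩
  calc (Set.range f).ncard ≤ (Set.range F).ncard := Set.ncard_le_ncard hsub (Set.toFinite _)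
    _ ≤ Nat.card (↥S ↪ U) := by
        rw [← Set.image_univ, ← Set.ncard_univ]
        exact Set.ncard_image_le (Set.toFinite _)
    _ = (Fintype.card U).descFactorial S.card := by
        rw [Nat.card_eq_fintype_card, Fintype.card_embedding_eq, Fintype.card_coe]

/-- The same bound in the form `|U|^{|S|}`. [cite: DawarPagoSeppelt2025, §5] -/
theorem ncard_range_le_pow_of_agree (S : Finset U) (f : Equiv.Perm U → α)
    (hf : ∀ σ τ : Equiv.Perm U, (∀ u ∈ S, σ u = τ u) → f σ = f τ) :
    (Set.range f).ncard ≤ Fintype.card U ^ S.card :=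
  (ncard_range_le_descFactorial_of_agree S f hf).trans (Nat.descFactorial_le_pow _ _)

omit [Fintype U] [DecidableEq U] in
/-- Two permutations agreeing on `S` differ by an element of the pointwise stabiliser of `S`, so they
act alike on every point SUPPORTED by `S` (Mathlib `MulAction.Supports`; Dawar–Wilsenach Def. 6.1).
[cite: DawarWilsenach2025, Def. 6.1] -/
theorem smul_eq_smul_of_supports_of_agree [MulAction (Equiv.Perm U) α] {S : Finset U} {a : α}
    (h : MulAction.Supports (Equiv.Perm U) (S : Set U) a) {σ τ : Equiv.Perm U}
    (hστ : ∀ u ∈ S, σ u = τ u) : σ • a = τ • a := by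
  have hfix : (τ⁻¹ * σ) • a = a := h (τ⁻¹ * σ) fun u hu => by
    change (τ⁻¹ * σ) u = u
    rw [Equiv.Perm.mul_apply, hστ u hu]
    exact τ.symm_apply_apply u
  rwa [mul_smul, inv_smul_eq_iff] at hfix

/-- **The support bound on orbits**: a point of a `Sym(U)`-set supported by a finite set `S`
(Dawar–Wilsenach Def. 6.1: the pointwise stabiliser of `S` fixes it) has an orbit of size at most
`|U| (|U|-1) ⋯ (|U|-|S|+1)`. [cite: DawarWilsenach2025, Def. 6.1; DawarPagoSeppelt2025, §5] -/
theorem ncard_orbit_le_descFactorial_of_supports [MulAction (Equiv.Perm U) α] {S : Finset U} {a : α}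
    (h : MulAction.Supports (Equiv.Perm U) (S : Set U) a) :
    (MulAction.orbit (Equiv.Perm U) a).ncard ≤ (Fintype.card U).descFactorial S.card :=
  ncard_range_le_descFactorial_of_agree S (fun σ => σ • a)
    fun _ _ hστ => smul_eq_smul_of_supports_of_agree h hστ

/-- The support bound in the form `|U|^{|S|}`. [cite: DawarWilsenach2025, Def. 6.1] -/
theorem ncard_orbit_le_pow_of_supports [MulAction (Equiv.Perm U) α] {S : Finset U} {a : α}
    (h : MulAction.Supports (Equiv.Perm U) (S : Set U) a) :
    (MulAction.orbit (Equiv.Perm U) a).ncard ≤ Fintype.card U ^ S.card :=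
  (ncard_orbit_le_descFactorial_of_supports h).trans (Nat.descFactorial_le_pow _ _)

end Counting

/-! ### Orbit size through rigid supports -/

namespace LabelledArithCircuit

universe u' v' w' z'

variable {K : Type u'} {X : Type v'} {Y : Type z'} {G : Type w'} {U : Type*} [Fintype U]
  [DecidableEq U] [MulAction (Equiv.Perm U) X] [MulAction (Equiv.Perm U) Y]

/-- **`ORB` through rigid supports.** Let `C` be a REDUCED labelled circuit on which every
`σ ∈ Sym(U)` acts by a designed automorphism `perm σ`, and suppose every gate `g` carries a finite set
`supp g` of at most `k` indices such that `perm σ g` depends only on `σ` restricted to `supp g`.  Then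
every orbit of `C` (under ALL automorphisms, Dawar–Wilsenach §3.3) has at most
`|U| (|U|-1) ⋯ (|U|-k+1)`-many — in particular at most `|U|^k` — gates: `ORB(C) ≤ |U|^k`
(for nonempty `U`).  This is the converse ("easy") half of the support theorems, in ORBIT currency and
independent of the number of gates. [cite: DawarWilsenach2025, §3.3 and Def. 6.1; DawarPagoSeppelt2025, §5] -/
theorem IsReduced.orbitSize_le_pow_of_agree [Fintype G] [Nonempty U] {C : LabelledArithCircuit K X Y G}
    (hR : C.IsReduced) (perm : Equiv.Perm U → Equiv.Perm G)
    (hperm : ∀ σ, C.IsAutomorphismExtending σ (perm σ)) (supp : G → Finset U) {k : ℕ}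
    (hk : ∀ g, (supp g).card ≤ k)
    (hagree : ∀ (g : G) (σ τ : Equiv.Perm U), (∀ u ∈ supp g, σ u = τ u) → perm σ g = perm τ g) :
    C.orbitSize (Equiv.Perm U) ≤ Fintype.card U ^ k :=
  hR.orbitSize_le perm hperm fun g =>
    (ncard_range_le_pow_of_agree (supp g) (fun σ => perm σ g) (hagree g)).trans
      (Nat.pow_le_pow_right Fintype.card_pos (hk g))

end LabelledArithCircuit

namespace SymmetricArithmeticCircuit

universe u' v' w' z'

variable {K : Type u'} {X : Type v'} {Y : Type z'} {G : Type w'} {U : Type*} [Fintype U]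
  [DecidableEq U] [MulAction (Equiv.Perm U) X] [MulAction (Equiv.Perm U) Y]
  [MulAction (Equiv.Perm U) G]

omit [Fintype U] [DecidableEq U] in
/-- For a REDUCED circuit carrying a `Sym(U)`-action by automorphisms (the bundled
`SymmetricArithmeticCircuit`), Dawar–Wilsenach's orbit of a gate is its orbit under the action.
[cite: DawarWilsenach2025, §3.3 (Orb; rigid circuits)] -/
theorem autOrbit_eq_orbit_of_isReduced (C : SymmetricArithmeticCircuit (Equiv.Perm U) K X Y G)
    (hR : C.toLabelledArithCircuit.IsReduced) (g : G) :
    C.autOrbit (Equiv.Perm U) g = MulAction.orbit (Equiv.Perm U) g := by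
  refine Set.Subset.antisymm
    (hR.autOrbit_subset_range (fun σ => MulAction.toPerm σ) C.isAutomorphismExtending_toPerm g) ?_
  rintro _ ⟨σ, rfl⟩
  exact ⟨σ, MulAction.toPerm σ, C.isAutomorphismExtending_toPerm σ, rfl⟩

/-- **`ORB ≤ |U|^{SP}` for reduced circuits** (Dawar–Wilsenach Def. 6.1: `sp(g)` = least size of a
support, `SP(C)` = its maximum): if every gate of a reduced `Sym(U)`-circuit has a support of size
`≤ k`, then every orbit has at most `|U|^k` gates. [cite: DawarWilsenach2025, Def. 6.1 and §3.3] -/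
theorem orbitSize_le_pow_of_isSupport [Fintype G] [Nonempty U]
    (C : SymmetricArithmeticCircuit (Equiv.Perm U) K X Y G) (hR : C.toLabelledArithCircuit.IsReduced)
    {k : ℕ} (hS : ∀ g : G, ∃ S : Finset U, S.card ≤ k ∧ C.IsSupport (S : Set U) g) :
    C.orbitSize (Equiv.Perm U) ≤ Fintype.card U ^ k := by
  refine hR.orbitSize_le (fun σ => MulAction.toPerm σ) C.isAutomorphismExtending_toPerm fun g => ?_
  obtain ⟨S, hSk, hSg⟩ := hS g
  exact (ncard_orbit_le_pow_of_supports (a := g) hSg).trans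
    (Nat.pow_le_pow_right Fintype.card_pos hSk)

end SymmetricArithmeticCircuit

end Literature.Computability.AlgebraicComplexity

end
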